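import Summits.NavierStokesRegularity.NavierStokesRegularity.Theses.ExtremalTypeIConstant
import HarnessLib

/-!
# Route `ExtremalTypeIConstant`, support item `TargetOfCruxes` — the cruxes imply the target

Settles `stmt-NavierStokesRegularity-8222`
(`Summit.NavierStokesRegularity.NavierStokesRegularity.Theses.ExtremalTypeIConstant.TargetOfCruxes`),
proved against the route decl itself (this module imports the route file, so the gate records the
closure as a docstring link rather than a re-imported `_holds` theorem).

The statement is pure logic: `ExtremalSpiralSymmetry → SpiralScalingLiouville → MinimiserExists →
TypeIAncientLiouville`. Given an element `u ∈ A_C` of the Type-I KNSS-mild ancient class with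
`u t x ≠ 0` at some `t < 0`, `MinimiserExists` produces an EXTREMAL pair `(C₀, w)` with
`0 < C₀ = ‖w(−1,0)‖` and `C₀` minimal among the constants of nontrivial elements;
`ExtremalSpiralSymmetry` gives a spiral-scaling symmetry `(a, A)` of `w`; `SpiralScalingLiouville`
then forces `w ≡ 0` on `t < 0`, in particular `w(−1,0) = 0`, contradicting `‖w(−1,0)‖ = C₀ > 0`.
This is the `hX` block of the route's deciding theorem `closes`, isolated as the support item.
No analysis is used.
-/

set_option linter.dupNamespace false -- nested layout Summit.<S>.<Sub>, Sub = S (D-0017)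

namespace Summit.NavierStokesRegularity.NavierStokesRegularity.Theorems

open Summit.NavierStokesRegularity.NavierStokesRegularity.Theses.ExtremalTypeIConstant

/-- **Glue: cruxes ⇒ target** (item stmt-NavierStokesRegularity-8222, route
`ExtremalTypeIConstant`; the type is literally the route decl `TargetOfCruxes`):
`ExtremalSpiralSymmetry → SpiralScalingLiouville → MinimiserExists → TypeIAncientLiouville`.
Proof: if `u t x ≠ 0` for some `u ∈ A_C`, `t < 0`, then `MinimiserExists` yields an extremal
`(C₀, w)` with `0 < C₀ = ‖w(−1,0)‖`; `ExtremalSpiralSymmetry` gives its spiral-scaling symmetry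
`(a, A)`; `SpiralScalingLiouville` gives `w(−1,0) = 0`, so `C₀ = ‖0‖ = 0`, contradicting
`0 < C₀`. [folklore: pure logic; the variational template is Merle 1993,
doi:10.1215/s0012-7094-93-06919-0, over the KNSS class of arXiv:0709.3599] -/
theorem extremalTypeIConstant_targetOfCruxes_proof :
    Summit.NavierStokesRegularity.NavierStokesRegularity.Theses.ExtremalTypeIConstant.TargetOfCruxes := by
  unfold TargetOfCruxes
  intro hSym hLiou hMin C u hu t ht x
  by_contra hne
  obtain ⟨C₀, w, hC₀, hw, hnorm, hminimal⟩ := hMin ⟨C, u, hu, t, ht, x, hne⟩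
  obtain ⟨a, A, hA, hsym⟩ := hSym C₀ w hC₀ ⟨hw, hnorm, hminimal⟩
  have hzero : w (-1) 0 = 0 := hLiou C₀ w hw ⟨a, A, hA, hsym⟩ (-1) (by norm_num) 0
  rw [hzero, norm_zero] at hnorm
  exact absurd hnorm (ne_of_lt hC₀)

end Summit.NavierStokesRegularity.NavierStokesRegularity.Theorems
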